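import Summits.CriticalPhenomena.PercolationContinuityZ3.Theorems.PercNearOneGluingNoHeavyLowerTailKnQuestion8CoefficientwiseNCAGlue
import HarnessLib

/-!
# Base members of the NCA class: comparable clusters, and a root lying on at most one edge — prim-lf-2 gen 63

Support file (`--supports stmt-CriticalPhenomena-4575`, closed), prover `prim-lf-2` (gen 63).  No definitions, no named facts, no sorries; standard axioms.
Memo `prim-lf-2/CW-NCA-gen63.md` §2.5.  Companion of `…CoefficientwiseNCAGlue.lean` (`nca_glue`: NCA-positivity is closed under gluing at a cut vertex): the trivial base pieces
from which `nca_glue` builds NCA-positive graphs (bridges, pendant roots, any piece hung through a single edge).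

NCA sums (NO-CORE with two-sided avoidance): for an edge set `E`, root `x`, vertex sets `X, W` and monotone `f, g`,
`NCA_E(x; X, W)[f,g] = Σ_{s ⊆ E : (∀ v ∈ X, v ∉ C_x s ∧ v ∉ C_x(E∖s)) ∧ (∀ w ∈ W, ¬(w ∈ C_x s ∧ w ∈ C_x(E∖s)))} (f(C_x s) − f(C_x(E∖s)))(g(C_x s) − g(C_x(E∖s)))`.
* `Coefficientwise.nca_of_comparable` — if for every colouring `s ⊆ E` the two clusters `C_x(s)`, `C_x(E∖s)` are `⊆`-comparable, every NCA sum is `≥ 0` (termwise).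
* `Coefficientwise.openCluster_eq_of_root_isolated` — if the root meets no edge of `s`, then `C_x(s) = {x}`.
* `Coefficientwise.nca_of_root_on_one_edge` — if the root `x` lies on at most one edge of `E` (a pendant root: one of the two clusters is always `{x}`), every NCA sum of
  `(E, x)` is `≥ 0` — whatever the rest of the multigraph is.  With `nca_glue`: bridges and pendant pieces may be hung anywhere on an NCA-positive graph.
[cite: KozmaNitzan2024, Questions 8–9 (§5.5 p. 36) (context: the Question-8 pocket covariance programme)]
-/

namespace Summit.CriticalPhenomena.PercolationContinuityZ3.Theorems

open Finset Literature.Probability.Percolation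

namespace Coefficientwise

variable {ι V : Type*} [DecidableEq ι]

open Classical in
/-- **Comparable clusters give NCA termwise.**  If for every `s ⊆ E` one of `C_x(s) ⊆ C_x(E∖s)`, `C_x(E∖s) ⊆ C_x(s)` holds, then for all `X, W` and monotone `f, g` the NCA sum
of `(E, x)` is nonnegative: every summand is a product of two numbers of the same sign. [cite: KozmaNitzan2024, Questions 8–9 (§5.5 p. 36) (context)] -/
theorem nca_of_comparable (ends : ι → Sym2 V) (E : Finset ι) (x : V)
    (hcomp : ∀ s, s ⊆ E → openCluster (ends '' (↑s : Set ι)) x ⊆ openCluster (ends '' (↑(E \ s) : Set ι)) x ∨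
      openCluster (ends '' (↑(E \ s) : Set ι)) x ⊆ openCluster (ends '' (↑s : Set ι)) x)
    (X W : Set V) (f g : Set V → ℝ) (hf : Monotone f) (hg : Monotone g) :
    0 ≤ ∑ s ∈ E.powerset.filter (fun s : Finset ι =>
            (∀ v ∈ X, v ∉ openCluster (ends '' (↑s : Set ι)) x ∧ v ∉ openCluster (ends '' (↑(E \ s) : Set ι)) x) ∧
            (∀ w ∈ W, ¬ (w ∈ openCluster (ends '' (↑s : Set ι)) x ∧ w ∈ openCluster (ends '' (↑(E \ s) : Set ι)) x))),
      (f (openCluster (ends '' (↑s : Set ι)) x) - f (openCluster (ends '' (↑(E \ s) : Set ι)) x)) *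
        (g (openCluster (ends '' (↑s : Set ι)) x) - g (openCluster (ends '' (↑(E \ s) : Set ι)) x)) := by
  refine Finset.sum_nonneg fun s hs => ?_
  have hsE : s ⊆ E := Finset.mem_powerset.mp (Finset.mem_filter.mp hs).1
  rcases hcomp s hsE with h | h
  · exact mul_nonneg_of_nonpos_of_nonpos (sub_nonpos.mpr (hf h)) (sub_nonpos.mpr (hg h))
  · exact mul_nonneg (sub_nonneg.mpr (hf h)) (sub_nonneg.mpr (hg h))

omit [DecidableEq ι] in
/-- If the root `x` meets no edge of `s`, its cluster is `{x}`. [cite: KozmaNitzan2024, §5.5 (context only; folklore)] -/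
theorem openCluster_eq_of_root_isolated (ends : ι → Sym2 V) {s : Finset ι} {x : V} (hx : ∀ e ∈ s, x ∉ ends e) :
    openCluster (ends '' (↑s : Set ι)) x = {x} := by
  ext y
  constructor
  · intro hy
    by_contra hyx
    have hyx' : y ≠ x := hyx
    -- `x` is reachable from `y`, so `x` meets an edge of `s`
    have hxy : x ∈ openCluster (ends '' (↑s : Set ι)) y := by
      change (openGraph (ends '' (↑s : Set ι))).Reachable y x
      exact (show (openGraph (ends '' (↑s : Set ι))).Reachable x y from hy).symm
    obtain ⟨e, he, hxe⟩ := exists_edge_of_mem_openCluster ends hxy (Ne.symm hyx')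
    exact hx e he hxe
  · intro hy
    rw [Set.mem_singleton_iff] at hy
    rw [hy]
    exact mem_openCluster_self _ x

open Classical in
/-- **Pendant root.**  If the root `x` lies on at most one edge of `E`, then for every colouring one of the two clusters of `x` is `{x}`, so the clusters are comparable and
every NCA sum of `(E, x)` is nonnegative — for instance a single edge (a bridge block), or an arbitrary multigraph reached from `x` through one edge.
[cite: KozmaNitzan2024, Questions 8–9 (§5.5 p. 36) (context)] -/
theorem nca_of_root_on_one_edge (ends : ι → Sym2 V) (E : Finset ι) (x : V)
    (hx : ∀ e ∈ E, ∀ e' ∈ E, x ∈ ends e → x ∈ ends e' → e = e')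
    (X W : Set V) (f g : Set V → ℝ) (hf : Monotone f) (hg : Monotone g) :
    0 ≤ ∑ s ∈ E.powerset.filter (fun s : Finset ι =>
            (∀ v ∈ X, v ∉ openCluster (ends '' (↑s : Set ι)) x ∧ v ∉ openCluster (ends '' (↑(E \ s) : Set ι)) x) ∧
            (∀ w ∈ W, ¬ (w ∈ openCluster (ends '' (↑s : Set ι)) x ∧ w ∈ openCluster (ends '' (↑(E \ s) : Set ι)) x))),
      (f (openCluster (ends '' (↑s : Set ι)) x) - f (openCluster (ends '' (↑(E \ s) : Set ι)) x)) *
        (g (openCluster (ends '' (↑s : Set ι)) x) - g (openCluster (ends '' (↑(E \ s) : Set ι)) x)) := by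
  refine nca_of_comparable ends E x (fun s hsE => ?_) X W f g hf hg
  have hsingle : ∀ t : Finset ι, openCluster (ends '' (↑t : Set ι)) x = {x} →
      openCluster (ends '' (↑t : Set ι)) x ⊆ openCluster (ends '' (↑(E \ s) : Set ι)) x ∧
      openCluster (ends '' (↑t : Set ι)) x ⊆ openCluster (ends '' (↑s : Set ι)) x := by
    intro t ht
    rw [ht]
    exact ⟨Set.singleton_subset_iff.mpr (mem_openCluster_self _ x), Set.singleton_subset_iff.mpr (mem_openCluster_self _ x)⟩
  by_cases h : ∃ e ∈ s, x ∈ ends e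
  · -- the unique edge at `x` is red: no blue edge meets `x`
    obtain ⟨e, hes, hxe⟩ := h
    have hblue : ∀ e' ∈ E \ s, x ∉ ends e' := by
      intro e' he' hxe'
      have hee' : e = e' := hx e (hsE hes) e' (Finset.mem_sdiff.mp he').1 hxe hxe'
      exact (Finset.mem_sdiff.mp he').2 (hee' ▸ hes)
    exact Or.inr (hsingle (E \ s) (openCluster_eq_of_root_isolated ends hblue)).2
  · push Not at h
    exact Or.inl (hsingle s (openCluster_eq_of_root_isolated ends h)).1

end Coefficientwise

end Summit.CriticalPhenomena.PercolationContinuityZ3.Theorems
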